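import Mathlib
import Summits.Ventures.PercRepro2.SwOutAll
import Summits.Ventures.PercRepro2.SwOutArmFlip
import Summits.Ventures.PercRepro2.SwOutJunctionFine
import Summits.Ventures.PercRepro2.SwOutJunctionsSplit

/-!
# Fine configurations for a set of split vertices (blind cell PercRepro2, night-4 g11,
2026-08-25; proofs/NIGHT4-G11.md §5(3))

`MFine ends S h η`: every copy of a vertex of `S` lies in the split hull of `h`.  On such
configurations (independent `S`, `h ∉ S`) the split graph sees the clusters of `h`
(`cluster_eq_of_mfine`), the rigid edge sets (`redEdges_eq_of_mfine`, `blueEdges_eq_of_mfine`),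
the outside class (`mem_outClass_splitS_of_mem`, `mem_outClass_of_mem_splitS`) and the side `Q`
(`mem_tgtU_splitS_of_mem`, `mem_tgtU_of_mem_splitS`); `MFine` is equivalent to every vertex of `S`
being MATCHED when the neighbours of `S` are adjacent to `h` and the cores lie in `{h} ∪ S`
(`mfine_of_matched`, `matched_of_mfine`).  The single-vertex results of `SwOutJunctionFine` /
`SwOutJunctionRegion` are the case `S = {u}`.
-/

namespace Summit.Ventures.PercRepro2

namespace LocRows

open Hull

variable {V : Type*} {E : Type*} [Fintype E] [DecidableEq E]

open scoped Classical

section FineS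

variable (ends : E → Sym2 V) (S : Set V) (h : V)

/-- **`S`-fine**: all copies of the vertices of `S` lie in the split hull of `h`. -/
def MFine (η : Config E) : Prop :=
  ∀ e, (∃ u ∈ S, u ∈ ends e) → Sum.inr e ∈ hull (splitEndsS ends S) η (Sum.inl h)

variable {ends S h}

omit [Fintype E] [DecidableEq E] in
/-- `S`-fineness is colour-symmetric. -/
lemma mfine_blue_iff {η : Config E} : MFine ends S h (blue η) ↔ MFine ends S h η := by
  simp only [MFine, hull_blue]

omit [Fintype E] [DecidableEq E] in
/-- A copy in the split hull lies on the side of its own colour. -/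
lemma inr_mem_cluster_splitS_of_mfine (hind : IndepSet ends S) {η : Config E}
    (hf : MFine ends S h η) {e : E} {u : V} (hu : u ∈ S) (he : u ∈ ends e) (hred : η e = true) :
    Sum.inr e ∈ cluster (splitEndsS ends S) η (Sum.inl h) := by
  rcases hf e ⟨u, hu, he⟩ with h1 | h1
  · exact h1
  · rw [inr_mem_cluster_splitS_iff hind hu he, blue_eq_true_iff] at h1
    rw [h1.1] at hred
    exact absurd hred (by simp)

omit [Fintype E] [DecidableEq E] in
/-- **The red cluster of `h` through the split** (`S`-fine, independent `S`, `h ∉ S`). -/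
theorem cluster_eq_of_mfine (hind : IndepSet ends S) (hhS : h ∉ S) {η : Config E}
    (hf : MFine ends S h η) :
    cluster ends η h =
      {x | x ∉ S ∧ Sum.inl x ∈ cluster (splitEndsS ends S) η (Sum.inl h)} ∪
      {x | x ∈ S ∧ ∃ e, ∃ _ : x ∈ ends e, η e = true ∧
        Sum.inr e ∈ cluster (splitEndsS ends S) η (Sum.inl h)} := by
  apply Set.Subset.antisymm
  · intro x hx
    refine mem_of_conn_of_closed (ends := ends) (ω := η) ?_
      (Or.inl ⟨hhS, mem_cluster_self _ _ _⟩) hx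
    intro a ha b hab
    obtain ⟨hne, e, he, hends⟩ := openGraph_adj.1 hab
    rcases ha with ⟨haS, haC⟩ | ⟨haS, e₁, he₁, hη₁, hC₁⟩
    · by_cases hbS : b ∈ S
      · have hbe : b ∈ ends e := by rw [hends]; exact Sym2.mem_mk_right _ _
        have hoth : Sym2.Mem.other hbe = a := other_eq_of_endsS hbe (ends_swap hends) hne
        right
        refine ⟨hbS, e, hbe, he, ?_⟩
        rw [inr_mem_cluster_splitS_iff hind hbS hbe, hoth]
        exact ⟨he, haC⟩
      · left
        exact ⟨hbS, mem_cluster_of_edge (v := Sum.inl h) haC he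
          (splitEndsS_of_notMem hends haS hbS)⟩
    · -- `a ∈ S`: the edge `e` is a red edge at `a`, its copy lies in the split hull
      have hae : a ∈ ends e := by rw [hends]; exact Sym2.mem_mk_left _ _
      have hoth : Sym2.Mem.other hae = b := other_eq_of_endsS hae hends (Ne.symm hne)
      have hcopy := inr_mem_cluster_splitS_of_mfine hind hf haS hae he
      rw [inr_mem_cluster_splitS_iff hind haS hae, hoth] at hcopy
      left
      refine ⟨?_, hcopy.2⟩
      intro hbS
      exact hind e a haS b hbS hends
  · rintro x (⟨_, hx⟩ | ⟨hxS, e, he, hη, hC⟩)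
    · exact conn_of_conn_splitS_inl hind hx
    · obtain ⟨u, huS, hue, _, hc⟩ := conn_of_conn_splitS_inr hind hC
      have huu : u = x := eq_of_two_mem_indep hind hxS huS he hue
      subst huu
      exact mem_cluster_of_edge hc hη (ends_swap (ends_eq_otherS hue))

omit [Fintype E] [DecidableEq E] in
/-- The `inl`-membership half of `cluster_eq_of_mfine`. -/
lemma inl_mem_cluster_splitS_iff_of_mfine (hind : IndepSet ends S) (hhS : h ∉ S) {η : Config E}
    (hf : MFine ends S h η) {x : V} (hxS : x ∉ S) :
    Sum.inl x ∈ cluster (splitEndsS ends S) η (Sum.inl h) ↔ x ∈ cluster ends η h := by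
  constructor
  · exact conn_of_conn_splitS_inl hind
  · intro hx
    rw [cluster_eq_of_mfine hind hhS hf] at hx
    rcases hx with ⟨_, h1⟩ | ⟨h1, _⟩
    · exact h1
    · exact absurd h1 hxS

omit [Fintype E] [DecidableEq E] in
/-- **The red edge set through the split** (`S`-fine, independent `S`, `h ∉ S`). -/
theorem redEdges_eq_of_mfine (hind : IndepSet ends S) (hhS : h ∉ S) {η : Config E}
    (hf : MFine ends S h η) :
    redEdges ends η h = redEdges (splitEndsS ends S) η (Sum.inl h) := by
  ext e
  simp only [mem_redEdges, mem_within]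
  constructor
  · rintro ⟨he, x, hx, y, hy, hxy⟩
    refine ⟨he, ?_⟩
    by_cases hu : ∃ u ∈ S, u ∈ ends e
    · obtain ⟨u, huS, hue⟩ := hu
      have hp : Sym2.Mem.other hue ∈ cluster ends η h := by
        have h1 : s(u, Sym2.Mem.other hue) = s(x, y) := (Sym2.other_spec hue).trans hxy
        rw [Sym2.eq_iff] at h1
        rcases h1 with ⟨_, h2⟩ | ⟨_, h2⟩
        · rw [h2]; exact hy
        · rw [h2]; exact hx
      have hpS := other_notMem_of_indep hind huS hue
      have hp' : Sum.inl (Sym2.Mem.other hue) ∈ cluster (splitEndsS ends S) η (Sum.inl h) :=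
        (inl_mem_cluster_splitS_iff_of_mfine hind hhS hf hpS).2 hp
      refine ⟨Sum.inr e, ?_, Sum.inl (Sym2.Mem.other hue), hp', splitEndsS_of_mem' hind huS hue⟩
      rw [inr_mem_cluster_splitS_iff hind huS hue]
      exact ⟨he, hp'⟩
    · push Not at hu
      have hxS : x ∉ S := fun h' => hu x h' (by rw [hxy]; exact Sym2.mem_mk_left _ _)
      have hyS : y ∉ S := fun h' => hu y h' (by rw [hxy]; exact Sym2.mem_mk_right _ _)
      exact ⟨Sum.inl x, (inl_mem_cluster_splitS_iff_of_mfine hind hhS hf hxS).2 hx,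
        Sum.inl y, (inl_mem_cluster_splitS_iff_of_mfine hind hhS hf hyS).2 hy,
        splitEndsS_of_notMem hxy hxS hyS⟩
  · rintro ⟨he, x', hx', y', hy', hxy⟩
    refine ⟨he, ?_⟩
    by_cases hu : ∃ u ∈ S, u ∈ ends e
    · obtain ⟨u, huS, hue⟩ := hu
      rw [splitEndsS_of_mem' hind huS hue, Sym2.eq_iff] at hxy
      have hp : Sum.inl (Sym2.Mem.other hue) ∈ cluster (splitEndsS ends S) η (Sum.inl h) := by
        rcases hxy with ⟨_, h1⟩ | ⟨_, h1⟩
        · rw [h1]; exact hy'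
        · rw [h1]; exact hx'
      have hpT : Sym2.Mem.other hue ∈ cluster ends η h := conn_of_conn_splitS_inl hind hp
      refine ⟨Sym2.Mem.other hue, hpT, u, ?_, ends_swap (ends_eq_otherS hue)⟩
      exact mem_cluster_of_edge hpT he (ends_swap (ends_eq_otherS hue))
    · push Not at hu
      obtain ⟨p, q, hpq⟩ := exists_pairS (ends e)
      have hpS : p ∉ S := fun h' => hu p h' (by rw [hpq]; exact Sym2.mem_mk_left _ _)
      have hqS : q ∉ S := fun h' => hu q h' (by rw [hpq]; exact Sym2.mem_mk_right _ _)
      rw [splitEndsS_of_notMem hpq hpS hqS, Sym2.eq_iff] at hxy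
      rcases hxy with ⟨h1, h2⟩ | ⟨h1, h2⟩
      · rw [← h1] at hx'; rw [← h2] at hy'
        exact ⟨p, conn_of_conn_splitS_inl hind hx', q, conn_of_conn_splitS_inl hind hy', hpq⟩
      · rw [← h1] at hy'; rw [← h2] at hx'
        exact ⟨p, conn_of_conn_splitS_inl hind hy', q, conn_of_conn_splitS_inl hind hx', hpq⟩

omit [Fintype E] [DecidableEq E] in
/-- **The blue edge set through the split.** -/
theorem blueEdges_eq_of_mfine (hind : IndepSet ends S) (hhS : h ∉ S) {η : Config E}
    (hf : MFine ends S h η) :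
    blueEdges ends η h = blueEdges (splitEndsS ends S) η (Sum.inl h) :=
  redEdges_eq_of_mfine hind hhS (mfine_blue_iff.2 hf)

omit [Fintype E] [DecidableEq E] in
/-- **`S`-fine gives matched** at every vertex of `S`. -/
theorem matched_of_mfine (hind : IndepSet ends S) {η : Config E} (hf : MFine ends S h η) {u : V}
    (hu : u ∈ S) : Matched ends u h η := by
  intro e he _
  constructor
  · intro hc
    have h1 := inr_mem_cluster_splitS_of_mfine hind hf hu he hc
    rw [inr_mem_cluster_splitS_iff hind hu he] at h1
    exact conn_of_conn_splitS_inl hind h1.2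
  · intro hc
    have hb : blue η e = true := by rw [blue_eq_true_iff]; exact hc
    have h1 := inr_mem_cluster_splitS_of_mfine hind (mfine_blue_iff.2 hf) hu he hb
    rw [inr_mem_cluster_splitS_iff hind hu he] at h1
    exact conn_of_conn_splitS_inl hind h1.2

omit [Fintype E] [DecidableEq E] in
/-- **Matched at every vertex of `S` gives `S`-fine** (independent `S`, `h ∉ S`, the neighbours
`p ≠ h` of `S` adjacent to `h`, the cores in `{h} ∪ S`). -/
theorem mfine_of_matched (hind : IndepSet ends S) (hhS : h ∉ S)
    (hadj : ∀ u ∈ S, ∀ e (he : u ∈ ends e), Sym2.Mem.other he ≠ h →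
      ∃ e', ends e' = s(Sym2.Mem.other he, h))
    {η : Config E}
    (hcore : ∀ x, x ∈ cluster ends η h → x ∈ cluster ends (blue η) h → x = h ∨ x ∈ S)
    (hm : ∀ u ∈ S, Matched ends u h η) : MFine ends S h η := by
  rintro e ⟨u, hu, he⟩
  have hpS := other_notMem_of_indep hind hu he
  by_cases hph : Sym2.Mem.other he = h
  · cases hc : η e with
    | true =>
      left
      rw [inr_mem_cluster_splitS_iff hind hu he, hph]
      exact ⟨hc, mem_cluster_self _ _ _⟩
    | false =>
      right
      rw [inr_mem_cluster_splitS_iff hind hu he, hph]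
      exact ⟨by rw [blue_eq_true_iff]; exact hc, mem_cluster_self _ _ _⟩
  · obtain ⟨e', he'⟩ := hadj u hu e he hph
    have hsplit : splitEndsS ends S e' = s(Sum.inl (Sym2.Mem.other he), Sum.inl h) :=
      splitEndsS_of_notMem he' hpS hhS
    cases hc : η e with
    | true =>
      have hp : Sym2.Mem.other he ∈ cluster ends η h := (hm u hu e he hph).1 hc
      left
      rw [inr_mem_cluster_splitS_iff hind hu he]
      refine ⟨hc, ?_⟩
      cases hc' : η e' with
      | true => exact mem_cluster_of_edge (mem_cluster_self _ _ _) hc' (ends_swap hsplit)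
      | false =>
        have hb : blue η e' = true := by rw [blue_eq_true_iff]; exact hc'
        have hp' : Sym2.Mem.other he ∈ cluster ends (blue η) h :=
          mem_cluster_of_edge (mem_cluster_self _ _ _) hb (ends_swap he')
        rcases hcore _ hp hp' with h1 | h1
        · exact absurd h1 hph
        · exact absurd h1 hpS
    | false =>
      have hp : Sym2.Mem.other he ∈ cluster ends (blue η) h := (hm u hu e he hph).2 hc
      right
      rw [inr_mem_cluster_splitS_iff hind hu he]
      refine ⟨by rw [blue_eq_true_iff]; exact hc, ?_⟩
      cases hc' : η e' with
      | true =>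
        have hp' : Sym2.Mem.other he ∈ cluster ends η h :=
          mem_cluster_of_edge (mem_cluster_self _ _ _) hc' (ends_swap he')
        rcases hcore _ hp' hp with h1 | h1
        · exact absurd h1 hph
        · exact absurd h1 hpS
      | false =>
        have hb : blue η e' = true := by rw [blue_eq_true_iff]; exact hc'
        exact mem_cluster_of_edge (mem_cluster_self _ _ _) hb (ends_swap hsplit)

end FineS

end LocRows

end Summit.Ventures.PercRepro2
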